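import Literature.NumberTheory.LFunctions.WeilFirstPrimeMinorantV
import HarnessLib

/-!
# Moment-method certificates for TWISTED Weil weights, I: the minorant chain for an arbitrary even weight

Cell `rh-explicit`, WEIL TRACK — GRH ARM (Lean root `Summits/Ventures/WeilGRH/`, namespace
`Summit.Ventures.WeilGRH`).  The `ζ`-side moment-method (format-A) certificates of
`Literature/NumberTheory/LFunctions/WeilFirstPrime*.lean` (H. Yoshida's method, Adv. Stud. Pure Math. 21
(1992) §6: a certified piecewise-polynomial minorant `σ = wL − γ` of the frequency-side weight on `[0, T]`,
exact rational moments of `γ`, Taylor expansion in the moments of the test function, Bessel's inequality,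
kernel-checked PSD blocks) hard-wire ONE weight, the first-prime `ζ` weight
`w₂(τ) = Re ψ(1/4 + iτ/2) − √2 log 2 cos(τ log 2)`, in the cell-validity predicate `FPDCell.Valid`
(`WeilFirstPrimeMinorantV.lean`).  For the twisted forms `Q_χ` of the arm
(`Literature/NumberTheory/LFunctions/WeilFinitePrimeQuadraticChar.lean`: on the window `2t ≤ log 3`,
`Re Q_χ(g) = (1/2π)∫|ĝ(1/2+iτ)|² M_{χ,2}(τ) dτ` with
`M_{χ,2}(τ) = Re ψ(1/4 + a_χ/2 + iτ/2) + log q − log π − √2 log 2 · Re χ(2) cos(τ log 2)`, NO polar term)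
the weight changes with `χ(2)` and the parity, so this file redoes the chain layer ONCE for an ARBITRARY
weight function `w : ℝ → ℝ`:

* `CellValidW c w` — what the chain lemmas use about a cell: `0 ≤ u < v`, `σ ≤ w` on `[u, v]`, the
  signed bound `|wL − σ| ≤ bndQ wL`; `CellsOKW wL T cells w` — chain from `0` to `T`, every cell
  `CellValidW`, tail level `wL ≤ w(t)` for `|t| ≥ T`;
* the facts the certificate consumes, for `γ = cellsGamma₂ wL cells` (the SAME `γ` as on the `ζ` side, so its
  exact moments `cellsMomentQ₂`, `cellsAbsMomentQ`, `cellsBndSumQ`, `cellsBndMaxQ` are reused verbatim):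
  `level_sub_cellsGamma₂_leW` (`wL − γ(t) ≤ w(t)` for even `w`), `cellsGamma₂_eq_zeroW`,
  `integral_cellsGamma₂_mul_powW`, `abs_cellsGamma₂_le_bndSumW` (and, in the continuation file
  `TwistedMomentChainAbs.lean`, `abs_cellsGamma₂_le_bndMaxW`, `integral_abs_cellsGamma₂_mul_pow_leW`)
  (proofs verbatim from the `V` versions, `Valid ↦ CellValidW`);
* `CellValidW.of_valid` — the `ζ` cells are the case `w = w₂`.

Boolean cell checkers producing `CellsOKW` for the twisted weights (ripple sign `χ(2) ∈ {−1, 0, 1}`) and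
the certificate format + soundness over `CellsOKW` are in the sibling files `TwistedMomentCells.lean`,
`TwistedMomentCertificate.lean`.  Everything here is PROVED; no named facts, nothing about zeros of any
`L`-function.

## References

* H. Yoshida, *On Hermitian forms attached to zeta functions*, Adv. Stud. Pure Math. 21 (1992), §6.
* R. E. Moore, *Interval Analysis* (1966), Ch. 3.
-/

noncomputable section

open Complex Filter Set MeasureTheory
open scoped Real Topology

namespace Summit.Ventures.WeilGRH

open Literature.NumberTheory.LFunctions
open Literature.Analysis.ValidatedNumerics.Numerics
open Literature.Analysis.SpecialFunctions

/-! ## Valid cells and valid chains for an arbitrary weight -/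

/-- What the chain lemmas use about a first-prime-type cell as a minorant cell of the weight `w`:
`0 ≤ u < v`, `σ ≤ w` on the cell, and the signed bound `|wL − σ| ≤ bndQ wL` on the cell. [folklore] -/
structure CellValidW (c : FPDCell) (w : ℝ → ℝ) : Prop where
  /-- `0 ≤ u` -/
  u_nonneg : 0 ≤ c.psi.u
  /-- `u < v` -/
  u_lt_v : c.psi.u < c.psi.v
  /-- `σ ≤ w` on the cell -/
  sigma_le : ∀ {t : ℝ}, (c.psi.u : ℝ) ≤ t → t ≤ (c.psi.v : ℝ) → c.sigma t ≤ w t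
  /-- `|wL − σ| ≤ bndQ wL` on the cell -/
  abs_sub_le : ∀ (wL : ℚ) {t : ℝ}, (c.psi.u : ℝ) ≤ t → t ≤ (c.psi.v : ℝ) →
    |(wL : ℝ) - c.sigma t| ≤ c.bndQ wL

/-- `0 ≤ bndQ` for a valid cell. [folklore] -/
theorem CellValidW.bndQ_nonneg {c : FPDCell} {w : ℝ → ℝ} (h : CellValidW c w) (wL : ℚ) :
    0 ≤ c.bndQ wL :=
  FPDCell.bndQ_nonneg_of h.u_nonneg h.u_lt_v wL

/-- The `ζ`-side validity is validity for the first-prime weight `w₂`. [folklore] -/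
theorem CellValidW.of_valid {c : FPDCell} (h : c.Valid) :
    CellValidW c fun t ↦ reDigammaQuarter t - Real.sqrt 2 * Real.log 2 * Real.cos (t * Real.log 2) :=
  ⟨h.u_nonneg, h.u_lt_v, fun hut htv ↦ h.sigma_le hut htv, fun wL _ hut htv ↦ h.abs_sub_le wL hut htv⟩

/-- Validity is monotone in the weight: a minorant cell of `w` is one of any `w' ≥ w`. [folklore] -/
theorem CellValidW.mono {c : FPDCell} {w w' : ℝ → ℝ} (h : CellValidW c w) (hle : ∀ t, w t ≤ w' t) :
    CellValidW c w' :=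
  ⟨h.u_nonneg, h.u_lt_v, fun hut htv ↦ (h.sigma_le hut htv).trans (hle _),
    fun wL _ hut htv ↦ h.abs_sub_le wL hut htv⟩

/-- A valid chain at level `wL` on `[0, T]` for the weight `w`: consecutive valid cells from `0` to `T`,
and the tail level `wL ≤ w(t)` for `|t| ≥ T`. [folklore] -/
structure CellsOKW (wL T : ℚ) (cells : List FPDCell) (w : ℝ → ℝ) : Prop where
  /-- the cells form a chain from `0` to `T` -/
  chain : checkChain₂ cells 0 T = true
  /-- every cell is valid for `w` -/
  valid : ∀ c ∈ cells, CellValidW c w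
  /-- the tail level: `wL ≤ w(t)` for `|t| ≥ T` -/
  level : ∀ t : ℝ, (T : ℝ) ≤ |t| → (wL : ℝ) ≤ w t

/-- A valid chain for `w` is one for any `w' ≥ w`. [folklore] -/
theorem CellsOKW.mono {wL T : ℚ} {cells : List FPDCell} {w w' : ℝ → ℝ} (h : CellsOKW wL T cells w)
    (hle : ∀ t, w t ≤ w' t) : CellsOKW wL T cells w' :=
  ⟨h.chain, fun c hc ↦ (h.valid c hc).mono hle, fun t ht ↦ (h.level t ht).trans (hle t)⟩

section Chain

variable {wL : ℚ} {w : ℝ → ℝ}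

/-- A checked chain from `s` to `T` has `s ≤ T` and all cells inside `[s, T]`. [folklore] -/
theorem chain_boundsW {cells : List FPDCell} {s T : ℚ} (hchain : checkChain₂ cells s T = true)
    (hall : ∀ c ∈ cells, CellValidW c w) :
    s ≤ T ∧ ∀ c ∈ cells, s ≤ c.psi.u ∧ c.psi.v ≤ T := by
  induction cells generalizing s with
  | nil =>
    simp only [checkChain₂, decide_eq_true_eq] at hchain
    exact ⟨hchain.le, fun c hc ↦ by simp at hc⟩
  | cons c cs ih =>
    simp only [checkChain₂, Bool.and_eq_true, decide_eq_true_eq] at hchain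
    have hc := hall c (by simp)
    have huv := hc.u_lt_v
    have ih' := ih hchain.2 fun c' hc' ↦ hall c' (by simp [hc'])
    refine ⟨by rw [← hchain.1]; exact huv.le.trans ih'.1, fun c' hc' ↦ ?_⟩
    simp only [List.mem_cons] at hc'
    rcases hc' with rfl | hc'
    · exact ⟨hchain.1.ge, ih'.1⟩
    · have := ih'.2 c' hc'
      exact ⟨hchain.1 ▸ huv.le.trans this.1, this.2⟩

/-- `γ_{≥0}` vanishes off `[s, T)`. [folklore] -/
theorem gammaAux₂_eq_zeroW {cells : List FPDCell} {s T : ℚ} (hchain : checkChain₂ cells s T = true)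
    (hall : ∀ c ∈ cells, CellValidW c w) {x : ℝ} (hx : x < s ∨ (T : ℝ) ≤ x) :
    gammaAux₂ wL cells x = 0 := by
  induction cells generalizing s with
  | nil => rfl
  | cons c cs ih =>
    have hb := chain_boundsW hchain hall
    simp only [checkChain₂, Bool.and_eq_true, decide_eq_true_eq] at hchain
    have hcv : (c.psi.v : ℝ) ≤ T := by exact_mod_cast (hb.2 c (by simp)).2
    have huv : (c.psi.u : ℝ) < c.psi.v := by exact_mod_cast (hall c (by simp)).u_lt_v
    have hus : (c.psi.u : ℝ) = s := by exact_mod_cast hchain.1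
    simp only [gammaAux₂]
    rw [ih hchain.2 (fun c' hc' ↦ hall c' (by simp [hc'])) ?_, add_zero, Set.indicator_of_notMem]
    · rintro ⟨h1, h2⟩
      rcases hx with hx | hx <;> linarith
    · rcases hx with hx | hx
      · left; linarith
      · right; exact hx

/-- On `[s, T)`, `γ_{≥0}(x) = wL − σ_j(x)` for the cell containing `x`. [folklore] -/
theorem gammaAux₂_specW {cells : List FPDCell} {s T : ℚ} (hchain : checkChain₂ cells s T = true)
    (hall : ∀ c ∈ cells, CellValidW c w) {x : ℝ} (h1 : (s : ℝ) ≤ x) (h2 : x < T) :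
    ∃ c ∈ cells, (c.psi.u : ℝ) ≤ x ∧ x < c.psi.v ∧ gammaAux₂ wL cells x = wL - c.sigma x := by
  induction cells generalizing s with
  | nil =>
    simp only [checkChain₂, decide_eq_true_eq] at hchain
    rw [hchain] at h1
    linarith
  | cons c cs ih =>
    simp only [checkChain₂, Bool.and_eq_true, decide_eq_true_eq] at hchain
    have hus : (c.psi.u : ℝ) = s := by exact_mod_cast hchain.1
    have hall' : ∀ c' ∈ cs, CellValidW c' w := fun c' hc' ↦ hall c' (by simp [hc'])
    by_cases hxv : x < c.psi.v
    · refine ⟨c, by simp, by linarith, hxv, ?_⟩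
      simp only [gammaAux₂]
      have hmem : x ∈ Ico (c.psi.u : ℝ) c.psi.v := ⟨by linarith, hxv⟩
      rw [gammaAux₂_eq_zeroW hchain.2 hall' (Or.inl hxv), add_zero, Set.indicator_of_mem hmem]
    · push Not at hxv
      obtain ⟨c', hc', hr⟩ := ih hchain.2 hall' hxv
      refine ⟨c', by simp [hc'], hr.1, hr.2.1, ?_⟩
      simp only [gammaAux₂]
      rw [Set.indicator_of_notMem (fun h ↦ not_lt.2 hxv h.2), zero_add, hr.2.2]

end Chain

section Sound

variable {wL T : ℚ} {cells : List FPDCell} {w : ℝ → ℝ}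

/-- **Soundness of a certified minorant of an even weight.** `wL − γ(t) ≤ w(t)` for all real `t`. [folklore] -/
theorem level_sub_cellsGamma₂_leW (h : CellsOKW wL T cells w) (heven : ∀ t, w (-t) = w t) (t : ℝ) :
    (wL : ℝ) - cellsGamma₂ wL cells t ≤ w t := by
  have hchain := h.chain
  have hall := h.valid
  have hwt : w |t| = w t := by
    rcases le_or_gt 0 t with ht | ht
    · rw [abs_of_nonneg ht]
    · rw [abs_of_neg ht, heven]
  unfold cellsGamma₂
  have hx0 : (0 : ℝ) ≤ |t| := abs_nonneg t
  rcases lt_or_ge |t| (T : ℝ) with hxT | hxT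
  · obtain ⟨c, hc, hux, hxv, hval⟩ := gammaAux₂_specW hchain hall (by exact_mod_cast hx0) hxT
    rw [hval, sub_sub_cancel, ← hwt]
    exact (hall c hc).sigma_le hux hxv.le
  · rw [gammaAux₂_eq_zeroW hchain hall (Or.inr hxT), sub_zero]
    exact h.level t hxT

/-- `γ(t) = 0` for `|t| ≥ T`. [folklore] -/
theorem cellsGamma₂_eq_zeroW (h : CellsOKW wL T cells w) {t : ℝ} (ht : (T : ℝ) ≤ |t|) :
    cellsGamma₂ wL cells t = 0 :=
  gammaAux₂_eq_zeroW h.chain h.valid (Or.inr ht)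

/-- `0 ≤ T` for a valid chain. [folklore] -/
theorem CellsOKW.T_nonneg (h : CellsOKW wL T cells w) : 0 ≤ T := (chain_boundsW h.chain h.valid).1

end Sound

/-! ## Signed `γ`: the step-function bound and its moments -/

/-- `|γ_{≥0}(s)| ≤ step(s)` when all cells are valid. [folklore] -/
theorem abs_gammaAux₂_le_stepW {wL : ℚ} {cells : List FPDCell} {w : ℝ → ℝ}
    (hall : ∀ c ∈ cells, CellValidW c w) (s : ℝ) :
    |gammaAux₂ wL cells s| ≤ stepAux wL cells s := by
  induction cells with
  | nil => simp [gammaAux₂, stepAux]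
  | cons c cs ih =>
    simp only [gammaAux₂, stepAux]
    refine (abs_add_le _ _).trans (add_le_add ?_ (ih fun c' hc' ↦ hall c' (by simp [hc'])))
    by_cases hs : s ∈ Ico (c.psi.u : ℝ) c.psi.v
    · rw [Set.indicator_of_mem hs, Set.indicator_of_mem hs]
      exact (hall c (by simp)).abs_sub_le wL hs.1 hs.2.le
    · rw [Set.indicator_of_notMem hs, Set.indicator_of_notMem hs, abs_zero]

/-- `step` is bounded, nonnegative and measurable. [folklore] -/
theorem stepAux_propsW {wL : ℚ} {cells : List FPDCell} {w : ℝ → ℝ} (hall : ∀ c ∈ cells, CellValidW c w) :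
    (∃ B, ∀ s, 0 ≤ stepAux wL cells s ∧ stepAux wL cells s ≤ B) ∧ Measurable (stepAux wL cells) := by
  induction cells with
  | nil => exact ⟨⟨0, fun s ↦ by simp [stepAux]⟩, measurable_const⟩
  | cons c cs ih =>
    obtain ⟨⟨B, hB⟩, hm⟩ := ih fun c' hc' ↦ hall c' (by simp [hc'])
    have hb0 : (0 : ℝ) ≤ ((c.bndQ wL : ℚ) : ℝ) := by exact_mod_cast (hall c (by simp)).bndQ_nonneg wL
    refine ⟨⟨((c.bndQ wL : ℚ) : ℝ) + B, fun s ↦ ?_⟩, ?_⟩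
    · simp only [stepAux]
      by_cases hs : s ∈ Ico (c.psi.u : ℝ) c.psi.v
      · rw [Set.indicator_of_mem hs]; exact ⟨add_nonneg hb0 (hB s).1, add_le_add le_rfl (hB s).2⟩
      · rw [Set.indicator_of_notMem hs, zero_add]
        exact ⟨(hB s).1, (hB s).2.trans (by linarith)⟩
    · change Measurable fun s ↦
        Set.indicator (Ico (c.psi.u : ℝ) c.psi.v) (fun _ ↦ ((c.bndQ wL : ℚ) : ℝ)) s + stepAux wL cs s
      exact (measurable_const.indicator measurableSet_Ico).add hm

/-- **Moments of the step bound.** `s ↦ step(s) s^q` is integrable and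
`∫ step(s) s^q ds = cellsAbsMomentQ`. [folklore] -/
theorem integral_stepAux_mul_powW {wL : ℚ} {cells : List FPDCell} {w : ℝ → ℝ}
    (hall : ∀ c ∈ cells, CellValidW c w) (q : ℕ) :
    Integrable (fun s ↦ stepAux wL cells s * s ^ q) ∧
      ∫ s, stepAux wL cells s * s ^ q = (cellsAbsMomentQ wL cells q : ℝ) := by
  induction cells with
  | nil => simp [stepAux, cellsAbsMomentQ]
  | cons c cs ih =>
    obtain ⟨ihi, ihv⟩ := ih fun c' hc' ↦ hall c' (by simp [hc'])
    have huv : (c.psi.u : ℝ) ≤ c.psi.v := by exact_mod_cast ((hall c (by simp)).u_lt_v).le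
    have e : (fun s ↦ stepAux wL (c :: cs) s * s ^ q) = fun s ↦
        Set.indicator (Ico (c.psi.u : ℝ) c.psi.v) (fun s ↦ ((c.bndQ wL : ℚ) : ℝ) * s ^ q) s +
          stepAux wL cs s * s ^ q := by
      funext s
      simp only [stepAux, add_mul, Set.indicator_mul_left]
    rw [e]
    have i1 : Integrable fun s : ℝ ↦
        Set.indicator (Ico (c.psi.u : ℝ) c.psi.v) (fun s ↦ ((c.bndQ wL : ℚ) : ℝ) * s ^ q) s := by
      rw [integrable_indicator_iff measurableSet_Ico]
      exact ((continuous_const.mul (continuous_pow q)).continuousOn.integrableOn_Icc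
        (a := (c.psi.u : ℝ)) (b := c.psi.v)).mono_set Ico_subset_Icc_self
    refine ⟨i1.add ihi, ?_⟩
    rw [integral_add i1 ihi, ihv, integral_indicator measurableSet_Ico, integral_Ico_eq_integral_Ioo,
      ← integral_Ioc_eq_integral_Ioo, ← intervalIntegral.integral_of_le huv,
      intervalIntegral.integral_const_mul, WeilCell.integral_pow_eq_powIntQ, cellsAbsMomentQ]
    push_cast
    ring

/-! ## Exact moments of the minorant -/

section Moments

variable {wL : ℚ} {w : ℝ → ℝ}

/-- **Moments of `γ_{≥0}`.** `s ↦ γ_{≥0}(s) s^q` is integrable and `∫ γ_{≥0}(s) s^q ds = Σ_j momentQ_j`. [folklore] -/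
theorem integral_gammaAux₂_mul_powW {cells : List FPDCell} (hall : ∀ c ∈ cells, CellValidW c w)
    (q : ℕ) :
    Integrable (fun s ↦ gammaAux₂ wL cells s * s ^ q) ∧
      ∫ s, gammaAux₂ wL cells s * s ^ q = (cellsMomentQ₂ wL cells q : ℝ) := by
  induction cells with
  | nil => simp [gammaAux₂, cellsMomentQ₂]
  | cons c cs ih =>
    obtain ⟨ihi, ihv⟩ := ih fun c' hc' ↦ hall c' (by simp [hc'])
    have huv : (c.psi.u : ℝ) ≤ c.psi.v := by exact_mod_cast ((hall c (by simp)).u_lt_v).le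
    have e : (fun s ↦ gammaAux₂ wL (c :: cs) s * s ^ q) = fun s ↦
        Set.indicator (Ico (c.psi.u : ℝ) c.psi.v) (fun s ↦ ((wL : ℝ) - c.sigma s) * s ^ q) s +
          gammaAux₂ wL cs s * s ^ q := by
      funext s
      simp only [gammaAux₂, add_mul, Set.indicator_mul_left]
    rw [e]
    have i1 := integrable_indicator_cell₂ wL c q
    refine ⟨i1.add ihi, ?_⟩
    rw [integral_add i1 ihi, ihv, integral_indicator measurableSet_Ico, integral_Ico_eq_integral_Ioo,
      ← integral_Ioc_eq_integral_Ioo, ← intervalIntegral.integral_of_le huv,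
      FPDCell.integral_level_sub_sigma_mul_pow, cellsMomentQ₂]
    push_cast
    ring

variable {T : ℚ} {cells : List FPDCell}

/-- **Moments of `γ`.** For even `q`, `t ↦ γ(t) t^q` is integrable and
`∫ γ(t) t^q dt = 2 Σ_j momentQ_j(q)`. [folklore] -/
theorem integral_cellsGamma₂_mul_powW (h : CellsOKW wL T cells w) {q : ℕ} (hq : Even q) :
    Integrable (fun t ↦ cellsGamma₂ wL cells t * t ^ q) ∧
      ∫ t, cellsGamma₂ wL cells t * t ^ q = 2 * (cellsMomentQ₂ wL cells q : ℝ) := by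
  have hchain := h.chain
  have hall := h.valid
  obtain ⟨hFi, hFv⟩ := integral_gammaAux₂_mul_powW hall q
  set F : ℝ → ℝ := fun s ↦ gammaAux₂ wL cells s * s ^ q with hF
  have hev : (fun t ↦ cellsGamma₂ wL cells t * t ^ q) = fun t ↦ F |t| := by
    funext t
    rw [hF, cellsGamma₂]
    simp only
    rw [hq.pow_abs]
  rw [hev]
  have hF0 : ∀ s, s ∉ Ici (0 : ℝ) → F s = 0 := fun s hs ↦ by
    rw [hF]
    simp only
    rw [gammaAux₂_eq_zeroW hchain hall (Or.inl (by simpa using hs)), zero_mul]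
  constructor
  · obtain ⟨B, hB⟩ := exists_abs_gammaAux₂_le wL cells
    have hT0 : (0 : ℝ) ≤ T := by exact_mod_cast (chain_boundsW hchain hall).1
    have hmeas : Measurable fun t ↦ F |t| := by
      rw [hF]
      exact ((measurable_gammaAux₂ wL cells).mul (measurable_id.pow_const q)).comp
        continuous_abs.measurable
    have hconst : IntegrableOn (fun _ : ℝ ↦ B * (T : ℝ) ^ q) (Icc (-(T : ℝ)) T) :=
      integrableOn_const measure_Icc_lt_top.ne
    refine Integrable.mono' ((integrable_indicator_iff measurableSet_Icc).2 hconst)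
      hmeas.aestronglyMeasurable (Eventually.of_forall fun t ↦ ?_)
    by_cases ht : |t| < T
    · have hmem : t ∈ Icc (-(T : ℝ)) T := ⟨by linarith [neg_abs_le t], by linarith [le_abs_self t]⟩
      rw [Set.indicator_of_mem hmem, hF, Real.norm_eq_abs]
      simp only
      rw [abs_mul, abs_pow, abs_abs]
      exact mul_le_mul (hB _) (pow_le_pow_left₀ (abs_nonneg t) ht.le q) (by positivity)
        ((abs_nonneg _).trans (hB 0))
    · push Not at ht
      rw [hF, Real.norm_eq_abs]
      simp only
      rw [gammaAux₂_eq_zeroW hchain hall (Or.inr ht), zero_mul, abs_zero]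
      exact Set.indicator_nonneg (fun _ _ ↦ by
        have := (abs_nonneg _).trans (hB 0); positivity) _
  · rw [integral_comp_abs (f := F), ← integral_Ici_eq_integral_Ioi,
      setIntegral_eq_integral_of_forall_compl_eq_zero hF0, hFv]

end Moments

/-- `step(s) ≤ Σ_j bnd_j`. [folklore] -/
theorem stepAux_le_bndSumW {wL : ℚ} {cells : List FPDCell} {w : ℝ → ℝ}
    (hall : ∀ c ∈ cells, CellValidW c w) (s : ℝ) : stepAux wL cells s ≤ (cellsBndSumQ wL cells : ℝ) := by
  induction cells with
  | nil => simp [stepAux, cellsBndSumQ]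
  | cons c cs ih =>
    simp only [stepAux, cellsBndSumQ]
    push_cast
    refine add_le_add ?_ (ih fun c' hc' ↦ hall c' (by simp [hc']))
    have hb0 : (0 : ℝ) ≤ ((c.bndQ wL : ℚ) : ℝ) := by exact_mod_cast (hall c (by simp)).bndQ_nonneg wL
    by_cases hs : s ∈ Ico (c.psi.u : ℝ) c.psi.v
    · rw [Set.indicator_of_mem hs]
    · rw [Set.indicator_of_notMem hs]; exact hb0

/-- `0 ≤ Σ_j bnd_j`. [folklore] -/
theorem cellsBndSumQ_nonnegW {wL : ℚ} {cells : List FPDCell} {w : ℝ → ℝ}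
    (hall : ∀ c ∈ cells, CellValidW c w) : (0 : ℝ) ≤ (cellsBndSumQ wL cells : ℝ) :=
  le_trans ((stepAux_propsW (wL := wL) hall).1.choose_spec 0).1 (stepAux_le_bndSumW hall 0)

end Summit.Ventures.WeilGRH

end
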